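import Summits.AtomisticToContinuum.Crystallization.Theorems.FrustratedLawDichotomyTransportPrice

/-!
# RepetitiveNetworkReduction · crux `RepetitiveNetworkLawGap` (stmt-AtomisticToContinuum-27235 → v2) — registered stub
# `stub_strictAtomMean` of the line «calibrated-transport» PROVED (decomp-a2c, lens 2 «structural dichotomy», generation 18)

The law-level half of the calibrated-transport line.  For a point-stationary probability law `P` almost surely carried by rooted
`δ`-hard-core configurations and a jointly measurable covariant transport `F` of finite mean out-flow, write
`Φ_F μ = rootEnergy V_LJ μ + in_F μ − out_F μ` for the redistributed root energy (`in_F μ = ∫⁻ y, F (θ_y μ) (−y) ∂μ`,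
`out_F μ = ∫⁻ y, F μ y ∂μ`, `θ_y μ = μ.map (· − y)`).  **If almost surely `Φ_F ≥ c` at the root (special atoms may be tight) and almost
surely SOME atom `g` of `μ` has `Φ_F (θ_g μ) > c` (a generic atom), then `c < E_P[rootEnergy V_LJ]`.**

Proof = the transport lemma's bookkeeping (`integral_redistributed_eq`: `E_P[Φ_F] = E_P[rootEnergy]`) + ONE new ingredient, the
**Mecke spreading of a null event along the atoms** (`ae_forall_atom_reroot_notMem`): for a measurable `P`-null set `N` of configurations,
almost surely no atom `g` of `μ` has `θ_g μ ∈ N` — the Mecke / point-stationarity identity (`IsPointStationaryLaw`, verbatim) applied to the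
payload `G(ν, y) = 1_N(ν)`, whose out-flow `1_N(μ)·μ(ℝ³)` vanishes a.s., so the in-flow `∫⁻ 1_N(θ_y μ) ∂μ(y) ≥ μ{g}·1_N(θ_g μ)` vanishes a.s.
If `E_P[rootEnergy] ≤ c` then `Φ_F = c` a.s., the event `{Φ_F ≠ c}` is null, hence seen at no atom — contradicting the generic atom.
All `[folklore]` (mass-transport principle [AldousLyons2007 §2], Mecke equation [LastPenrose2017 Thm 9.4 / Ch. 9]).
-/

noncomputable section

namespace Summit.AtomisticToContinuum.Crystallization.Theorems.RepetitiveNetworkReductionStrictAtomMean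

open MeasureTheory Set Filter
open scoped ENNReal
open Literature.MathematicalPhysics.StatisticalMechanics Literature.Probability.Process
open Summit.AtomisticToContinuum.Crystallization.Theorems.ChargedEnergyGapNegative (E3)
open Summit.AtomisticToContinuum.Crystallization.Theorems.FrustratedLawDichotomyFiniteClusterGap
  (aemeasurable_lintegral_reroot_of_ae_hardCore)
open Summit.AtomisticToContinuum.Crystallization.Theorems.FrustratedLawDichotomyTransportPrice
  (integral_redistributed_eq)

variable {δ : ℝ} {P : Measure (Measure E3)}

/-- **Mecke spreading of a null event along the atoms.**  For a point-stationary law almost surely carried by rooted `δ`-hard-core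
configurations and a measurable `P`-null set `N` of configurations: almost surely, NO atom `g` of `μ` has its re-rooted configuration
`θ_g μ = μ.map (· − g)` in `N`. [folklore] -/
theorem ae_forall_atom_reroot_notMem (hδ : 0 < δ) (hcore : ∀ᵐ μ ∂P, IsRootedHardCore δ μ) (hstat : IsPointStationaryLaw P)
    {N : Set (Measure E3)} (hN : MeasurableSet N) (hPN : P N = 0) :
    ∀ᵐ μ ∂P, ∀ g : E3, μ {g} ≠ 0 → (μ.map fun z => z - g) ∉ N := by
  -- the payload `G(ν, y) := 1_N(ν)` (constant in `y`)
  set G : Measure E3 → E3 → ℝ≥0∞ := fun ν _ => N.indicator 1 ν with hGdef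
  have hG : Measurable (Function.uncurry G) := by
    have h : Function.uncurry G = (N.indicator (1 : Measure E3 → ℝ≥0∞)) ∘ Prod.fst := by
      funext p
      rfl
    rw [h]
    exact (measurable_const.indicator hN).comp measurable_fst
  -- its out-flow vanishes almost surely (`P N = 0`), hence in the mean
  have hL : ∫⁻ μ, ∫⁻ y, G μ y ∂μ ∂P = 0 := by
    have hae : ∀ᵐ μ ∂P, (∫⁻ y, G μ y ∂μ) = 0 := by
      filter_upwards [measure_eq_zero_iff_ae_notMem.mp hPN] with μ hμ
      simp [hGdef, Set.indicator_of_notMem hμ]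
    rw [lintegral_congr_ae hae, lintegral_zero]
  -- Mecke: so does the mean in-flow `E_P ∫⁻ 1_N(θ_y μ) ∂μ(y)`
  have hR : ∫⁻ μ, ∫⁻ y, G (μ.map fun z => z - y) (-y) ∂μ ∂P = 0 := by
    rw [← hstat G hG]
    exact hL
  have hΨ : AEMeasurable (fun μ => ∫⁻ y, G (μ.map fun z => z - y) (-y) ∂μ) P :=
    aemeasurable_lintegral_reroot_of_ae_hardCore hδ hcore hG
  have hΨ0 : (fun μ => ∫⁻ y, G (μ.map fun z => z - y) (-y) ∂μ) =ᵐ[P] 0 := (lintegral_eq_zero_iff' hΨ).mp hR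
  filter_upwards [hΨ0] with μ hμ g hg hmem
  -- the in-flow of `μ` dominates `μ{g} · 1_N(θ_g μ) = μ{g} > 0`
  have h1 : ({g} : Set E3).indicator (1 : E3 → ℝ≥0∞) ≤ fun y => G (μ.map fun z => z - y) (-y) := by
    intro y
    by_cases hy : y = g
    · subst hy
      simp [hGdef, Set.indicator_of_mem hmem]
    · have hy' : y ∉ ({g} : Set E3) := by simpa using hy
      simp [Set.indicator_of_notMem hy']
  have h2 : μ {g} ≤ ∫⁻ y, G (μ.map fun z => z - y) (-y) ∂μ :=
    calc μ {g} = ∫⁻ y, ({g} : Set E3).indicator 1 y ∂μ := (lintegral_indicator_one (measurableSet_singleton g)).symm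
      _ ≤ ∫⁻ y, G (μ.map fun z => z - y) (-y) ∂μ := lintegral_mono h1
  have h3 : (∫⁻ y, G (μ.map fun z => z - y) (-y) ∂μ) = 0 := hμ
  have h4 : μ {g} ≤ 0 := by
    calc μ {g} ≤ ∫⁻ y, G (μ.map fun z => z - y) (-y) ∂μ := h2
      _ = 0 := h3
  exact hg (le_zero_iff.mp h4)

/-- **Registered stub `stub_strictAtomMean` of the line «calibrated-transport» on the crux `RepetitiveNetworkLawGap`** (text verbatim):
a calibrated transport — redistributed root energy `≥ c` at the root almost surely and `> c` at SOME atom almost surely — forces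
`c < E_P[rootEnergy V_LJ]` for every point-stationary probability law a.s. carried by rooted `δ`-hard-core configurations. [folklore] -/
theorem stub_strictAtomMean : ∀ δ : ℝ, 0 < δ → ∀ c : ℝ, ∀ P : MeasureTheory.Measure (MeasureTheory.Measure (EuclideanSpace ℝ (Fin 3))), ∀ F : MeasureTheory.Measure (EuclideanSpace ℝ (Fin 3)) → EuclideanSpace ℝ (Fin 3) → ENNReal, MeasureTheory.IsProbabilityMeasure P → (∀ᵐ μ ∂P, Literature.Probability.Process.IsRootedHardCore δ μ) → Literature.Probability.Process.IsPointStationaryLaw P → Measurable (Function.uncurry F) → (∫⁻ μ, ∫⁻ y, F μ y ∂μ ∂P) ≠ ⊤ → (∀ᵐ μ ∂P, c ≤ Literature.MathematicalPhysics.StatisticalMechanics.rootEnergy Literature.MathematicalPhysics.StatisticalMechanics.lennardJones μ + (∫⁻ y, F (MeasureTheory.Measure.map (fun z : EuclideanSpace ℝ (Fin 3) => z - y) μ) (-y) ∂μ).toReal - (∫⁻ y, F μ y ∂μ).toReal) → (∀ᵐ μ ∂P, (∃ g : EuclideanSpace ℝ (Fin 3), μ {g} ≠ 0 ∧ c < Literature.MathematicalPhysics.StatisticalMechanics.rootEnergy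 Literature.MathematicalPhysics.StatisticalMechanics.lennardJones (MeasureTheory.Measure.map (fun z : EuclideanSpace ℝ (Fin 3) => z - g) μ) + (∫⁻ y, F (MeasureTheory.Measure.map (fun z : EuclideanSpace ℝ (Fin 3) => z - y) (MeasureTheory.Measure.map (fun z : EuclideanSpace ℝ (Fin 3) => z - g) μ)) (-y) ∂(MeasureTheory.Measure.map (fun z : EuclideanSpace ℝ (Fin 3) => z - g) μ)).toReal - (∫⁻ y, F (MeasureTheory.Measure.map (fun z : EuclideanSpace ℝ (Fin 3) => z - g) μ) y ∂(MeasureTheory.Measure.map (fun z : EuclideanSpace ℝ (Fin 3) => z - g) μ)).toReal)) → c < (∫ μ, Literature.MathematicalPhysics.StatisticalMechanics.rootEnergy Literature.MathematicalPhysics.StatisticalMechanics.lennardJones μ ∂P) := by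
  intro δ hδ c P F hP hcore hstat hF hout hfloor hstrict
  haveI : IsProbabilityMeasure P := hP
  obtain ⟨hI, heq⟩ := integral_redistributed_eq hδ hcore hstat hF hout
  rw [← heq]
  set Φ : Measure E3 → ℝ := fun μ =>
    rootEnergy lennardJones μ + (∫⁻ y, F (μ.map fun z => z - y) (-y) ∂μ).toReal - (∫⁻ y, F μ y ∂μ).toReal with hΦ
  by_contra hle
  have hle' : ∫ μ, Φ μ ∂P ≤ c := not_lt.mp hle
  have hIc : Integrable (fun μ => Φ μ - c) P := hI.sub (integrable_const c)
  have hnn : 0 ≤ᵐ[P] fun μ => Φ μ - c := by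
    filter_upwards [hfloor] with μ hμ
    exact sub_nonneg.mpr hμ
  have hzero : ∫ μ, Φ μ - c ∂P = 0 := by
    refine le_antisymm ?_ (integral_nonneg_of_ae hnn)
    rw [integral_sub hI (integrable_const c), integral_const, smul_eq_mul, probReal_univ, one_mul]
    exact sub_nonpos.mpr hle'
  have hae : (fun μ => Φ μ - c) =ᵐ[P] 0 := (integral_eq_zero_iff_of_nonneg_ae hnn hIc).mp hzero
  -- the event «redistributed root energy ≠ c» is `P`-null; take a measurable null superset
  have hnull : P {μ | ¬ (Φ μ - c = 0)} = 0 := ae_iff.mp hae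
  set N : Set (Measure E3) := toMeasurable P {μ | ¬ (Φ μ - c = 0)} with hN
  have hNm : MeasurableSet N := measurableSet_toMeasurable _ _
  have hPN : P N = 0 := by
    rw [hN, measure_toMeasurable]
    exact hnull
  -- Mecke spreading: almost surely no atom sees `N`; but the generic atom does
  have hspread := ae_forall_atom_reroot_notMem hδ hcore hstat hNm hPN
  have hfalse : ∀ᵐ μ ∂P, False := by
    filter_upwards [hstrict, hspread] with μ hμ hsp
    obtain ⟨g, hg, hcg⟩ := hμ
    have hcg' : c < Φ (μ.map fun z => z - g) := hcg
    refine hsp g hg (subset_toMeasurable P _ ?_)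
    simp only [Set.mem_setOf_eq]
    intro h0
    linarith
  exact IsProbabilityMeasure.ne_zero P (ae_eq_bot.mp (Filter.eventually_false_iff_eq_bot.mp hfalse))

end Summit.AtomisticToContinuum.Crystallization.Theorems.RepetitiveNetworkReductionStrictAtomMean

end
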